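import Literature.MathematicalPhysics.QuantumFieldTheory.Balaban1983to89.B9Eq349TowerCutoffReadings
import Literature.MathematicalPhysics.QuantumFieldTheory.Balaban1983to89.B9Eq349ConjugatedQTowerLetters

/-!
# `Balaban1983to89.B9Eq349ConjugatedQTowerLettersCompanion` — T. Bałaban, *Propagators for lattice gauge theories in a background field*, Commun. Math.
# Phys. **99** (1985) 389–434 [Balaban1985BackgroundPropagators] (3.15)–(3.19) p. 393, (3.26) p. 395, (3.49) p. 399, (3.101)–(3.103) p. 414:
# **THE COMBES–THOMAS LETTERS OF THE TOWER AVERAGING `Q_k(U)` IN THE COMPANION SHAPE** — for ONE fine weight `χ` on `T_{L^{n+1}m}` with bond increments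
# `≤ ι`, ONE big-block companion `χ′` on `T_m` (`|χ′(y) − χ(x)| ≤ ℓ′` for `x` in the big block of `y`), the multipliers `M_B` (fine bonds) ∕ `M_F` (coarse
# bonds) and `κ` in the windows `‖κ‖(3ℓ′ + L^{n+1}ι) ≤ 1`, `‖κ‖·2dL^nι ≤ 1`:
# `‖exp(κ•M_F)(Q_k(U)(exp(κ•(−M_B))f)) − Q_k(U)f‖ ≤ M_φ′M_φ·√(c₁∕(c₀L^{(n+1)d}))·(Π_j(1 + √(L^d)(θ_j + ‖κ‖ω_j)) − Π_j(1 + √(L^d)θ_j))·‖f‖` with the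
# per-level readings `ω_0 = 2(3ℓ′ + L^{n+1}ι)√(…)`, `ω_j = 2(2dL^{n+1−j}ι)√(…)` SUBSTITUTED — gen 93's telescoped tower letter `B9Eq349ConjugatedQTowerLetters`
# (per-level cut-offs DISPLAYED) composed with gen 94's geometry `B9Eq349TowerCutoffReadings` (the cut-offs `χ_0 := χ′`, `χ_j := χ ∘ up_j` and their
# two-block readings): the `dQ` ∕ `dQ′` conjuncts of ne9-leaf-03's tower ENDs (GBT2) `B9Eq326DeltaABlockDecayTower.norm_block_G1k_le`, (H1DT), (EH1T)
# INHABITED at `Q := QkW`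

statement-level skeleton of published theorems with citation tags; proofs where landed; nothing here is a claim about the Yang–Mills mass gap

CITATION HEADER (lean-in-tree rule).  Audit cell `pub-balaban`, sub-cell `t4`, BINDER row NE9; filed by the NE9 BINDER-row OWNER lineage
`b2b-balaban-t4-ne9-p1` (gen 94).  Imports gen 94's `B9Eq349TowerCutoffReadings` (`exists_levelEmbedding`, `abs_sub_levels_le`, `abs_sub_level_zero_le`;
through it `B9Eq349ConjugatedQLettersCompanion.exp_neg_apply_exp` and (G) `B9Eq3101ExpPointwiseMultiplier`) and gen 93's `B9Eq349ConjugatedQTowerLetters`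
(`norm_conj_QkW_sub_le`, `norm_conj_adjoint_QkW_sub_le`, `conj_QadjQ_factor`; through it `B9Eq326OperatorTower.QkW` = print's `Q_k(U)` (3.15)∕(3.19) on the
chain's carriers).  Sources READ first-hand (`paper:balaban1985-cmp99-background-propagators`): p. 393 (3.15)–(3.19), p. 395 (3.26), p. 399 (3.49), p. 414
(3.101)–(3.103).  Print never conjugates `Q_k(U)`; the telescoping with intermediate weights is the ROUTE's device (gen 91 (β), gen 93) and every constant
below is the cell's.

WHAT IS PROVED (sorry-free; proof lane — no `def`; [folklore] composition BY NAME).  With the (3.35)-type TOWER letters of gen 93 displayed verbatim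
(`α_j`, `hU1`, `hreg` per level for `UlevOf`, `ε_U,j`, `hUε`), fibre `φ` (`M_φ`, `M_φ′`), weights `c₀`, `c₁`:
* §1 `readings_nonneg`, `readings_window` — the per-level readings `r_0 = 3ℓ′ + L^{n+1}ι`, `r_j = 2d·L^{n+1−j}·ι` (`j ≥ 1`) and their windows from the two
  displayed caps; `family_readings` — the family `χ_0 := χ′`, `χ_j := χ ∘ up_j` has gen 93's `hχ`.
* §2 **`norm_expConj_QkW_sub_le`** (`dQ` at the tower), **`norm_expConj_adjoint_QkW_sub_le`** (`dQ′`), **`exists_expConj_Qk_letters`** (the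
  `∃ Q_κ Q′_κ` bundle `hQfac ∧ dQ ∧ dQ′` of (CDT) `B9Eq326ConjugatedDeltaATower`).
* §3 `prod_add_sub_prod_le` (`Π(1+a_j+b_j) − Π(1+a_j) ≤ (Σb_j)·exp(Σ(a_j+b_j))`), **`norm_expConj_QkW_sub_le_linear`** — the `dQ` letter LINEAR IN THE
  RADIUS `‖κ‖ ≤ R` with an explicit slope `N_β(R)` (finite sums∕products over the levels; the `(N_β·r)` shape of the tower `∃`-first END (EH1T)).
HONEST SCOPE.  Composition; crude constants (the product difference is gen 93's, with the readings substituted — bounding it by a closed `N_β·‖κ‖` is the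
consumer's arithmetic); MODEL letters displayed; nothing of [B9] Thm 3.1∕3.3∕3.11 asserted, valued or discharged; «NE9 ⇐ the named binders»; NE9 NOT PRINTED ∕
NOT PROVED; row WALLED ON A MODEL (O-NE9-1; #5 UNRULED); spine PROVED 0∕9; rung (B)+1 on a finite T⁴ — NOT infinite volume, NOT mass gap, NOT BetaPertH, NOT
Clay.  HONEST DEPENDENCY: continuum YM on T⁴ ⇐ BetaPertH ∧ nine spine estimates (0/9 proved); BetaPertH ⇐ (D1) ∧ (D4) ∧ CAP+tail.  NEW file; nothing
modified.  Net new unproved facts: 0.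
-/

noncomputable section

set_option autoImplicit false

open scoped InnerProductSpace ComplexConjugate BigOperators
open NormedSpace

namespace Literature.MathematicalPhysics.QuantumFieldTheory.Balaban1983to89.B9Eq349ConjugatedQTowerLettersCompanion

open B4Sect5Torus (TSite)
open B9SectCLatticeCarrier (Bond bpos btgt shift)
open B7Prop1Explicit (U1 Wcx boxVec)
open B9Eq319QprimeTorus (fineP blockCoord)
open B9Eq311L2Pairing (WL2)
open B11Eq103H1Complex (BondL2K)
open B9Eq315QTorus (perCfg cornerSite)
open B9Eq315QTower (towerP towerP_apply UlevOf)
open B9Eq326OperatorTower (QkW)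
open B9Eq316TowerFlatIsOneStep (siteCast towerP_eq_fineP_pow)
open B9Eq349ConjugatedQLettersCompanion (exp_neg_apply_exp)
open B9Eq349TowerCutoffReadings (exists_levelEmbedding abs_sub_levels_le abs_sub_level_zero_le)
open B9Eq349ConjugatedQTowerLetters (norm_conj_QkW_sub_le norm_conj_adjoint_QkW_sub_le conj_QadjQ_factor)
open B9Eq3101ExpPointwiseMultiplier (equiv_exp_smul_apply_complex equiv_exp_smul_neg_apply_complex)

variable {d : ℕ} (L : ℕ) [NeZero L]
  {𝔸 : Type*} [NormedRing 𝔸] [NormedAlgebra ℂ 𝔸] [CompleteSpace 𝔸] [NormOneClass 𝔸]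
  (m : Fin d → ℕ) [∀ i, NeZero (m i)] (n : ℕ) (hL : 1 ≤ L) (hm : ∀ i, 1 ≤ m i)
  {W : Type*} [NormedAddCommGroup W] [InnerProductSpace ℂ W] [FiniteDimensional ℂ W] (φ : W ≃ₗ[ℂ] 𝔸) {Mφ Mφ' : ℝ} (hMφ : 0 ≤ Mφ) (hMφ' : 0 ≤ Mφ')
  (hφ : ∀ w, ‖φ w‖ ≤ Mφ * ‖w‖) (hφ' : ∀ X, ‖φ.symm X‖ ≤ Mφ' * ‖X‖) {c₀ c₁ : ℝ} [Fact (0 < c₀)] [Fact (0 < c₁)]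
  (U : Bond d (towerP L m (n + 1)) → 𝔸ˣ) (α : ℕ → ℝ) (hα1 : ∀ j, α j ≤ 1 / 64)
  (hU1 : ∀ (j : ℕ) (x : B7Prop1Explicit.Site d) (k : Fin d), perCfg (towerP L m (j + 1)) (UlevOf L m (n + 1) U j) x k ∈ U1 𝔸)
  (hreg : ∀ (j : ℕ) (y : TSite d (towerP L m j)) (k : Fin d) (r : Fin d → Fin L),
    ‖((Wcx L (perCfg (towerP L m (j + 1)) (UlevOf L m (n + 1) U j)) (cornerSite L y) k (boxVec L r) : 𝔸ˣ) : 𝔸) - 1‖ ≤ α j)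
  (εU : ℕ → ℝ) (hεU : ∀ j, 0 ≤ εU j)
  (hUε : ∀ (j : ℕ) (b : Bond d (towerP L m (j + 1))), ‖(UlevOf L m (n + 1) U j b : 𝔸) - 1‖ ≤ εU j)
  {χ : TSite d (towerP L m (n + 1)) → ℝ} {χ' : TSite d m → ℝ} {ι ℓ' : ℝ} (hι : 0 ≤ ι) (hℓ' : 0 ≤ ℓ')
  (hχ : ∀ b : Bond d (towerP L m (n + 1)), |χ (bpos b) - χ (btgt b)| ≤ ι)
  (hχ' : ∀ (y : TSite d m) (x : TSite d (towerP L m (n + 1))),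
    siteCast (towerP_eq_fineP_pow L m (n + 1)) x ∈ B9Eq319QprimeTorus.blockOf (L ^ (n + 1)) m y → |χ' y - χ x| ≤ ℓ')
  {MB : BondL2K ℂ d (towerP L m (n + 1)) c₀ W →L[ℂ] BondL2K ℂ d (towerP L m (n + 1)) c₀ W}
  (hMB : ∀ (g : BondL2K ℂ d (towerP L m (n + 1)) c₀ W) (b : Bond d (towerP L m (n + 1))),
    WL2.equiv ℂ (fun _ : Bond d (towerP L m (n + 1)) => c₀) W (MB g) b =
      (χ (bpos b) : ℂ) • WL2.equiv ℂ (fun _ : Bond d (towerP L m (n + 1)) => c₀) W g b)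
  {MF : BondL2K ℂ d m c₁ W →L[ℂ] BondL2K ℂ d m c₁ W}
  (hMF : ∀ (g : BondL2K ℂ d m c₁ W) (c : Bond d m),
    WL2.equiv ℂ (fun _ : Bond d m => c₁) W (MF g) c = (χ' (bpos c) : ℂ) • WL2.equiv ℂ (fun _ : Bond d m => c₁) W g c)
  {κ : ℂ} (hwin0 : ‖κ‖ * (3 * ℓ' + (L : ℝ) ^ (n + 1) * ι) ≤ 1) (hwin1 : ‖κ‖ * (2 * d * (L : ℝ) ^ n * ι) ≤ 1)

/-! ## §1 The per-level readings and the family of cut-offs -/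

omit [NeZero L] in
include hι hℓ' in
/-- The per-level readings `r_0 = 3ℓ′ + L^{n+1}ι`, `r_j = 2d·L^{n+1−j}·ι` are nonnegative. [folklore] [cite: Balaban1985BackgroundPropagators, (3.49) p.399] -/
theorem readings_nonneg (j : ℕ) : 0 ≤ (if j = 0 then 3 * ℓ' + (L : ℝ) ^ (n + 1) * ι else 2 * d * (L : ℝ) ^ (n + 1 - j) * ι) := by
  split_ifs <;> positivity

omit [NeZero L] in
include hι hL hwin0 hwin1 in
/-- The two displayed caps give every per-level window `‖κ‖·r_j ≤ 1` (`j < n+1`): `r_j ≤ 2dL^nι` for `1 ≤ j`. [folklore]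
[cite: Balaban1985BackgroundPropagators, (3.49) p.399, (3.101) p.414] -/
theorem readings_window (j : ℕ) (hj : j < n + 1) :
    ‖κ‖ * (if j = 0 then 3 * ℓ' + (L : ℝ) ^ (n + 1) * ι else 2 * d * (L : ℝ) ^ (n + 1 - j) * ι) ≤ 1 := by
  split_ifs with h
  · exact hwin0
  · have hL1 : (1 : ℝ) ≤ L := by exact_mod_cast hL
    have hle : (L : ℝ) ^ (n + 1 - j) ≤ (L : ℝ) ^ n := pow_le_pow_right₀ hL1 (by omega)
    calc ‖κ‖ * (2 * d * (L : ℝ) ^ (n + 1 - j) * ι) ≤ ‖κ‖ * (2 * d * (L : ℝ) ^ n * ι) := by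
          apply mul_le_mul_of_nonneg_left _ (norm_nonneg _)
          apply mul_le_mul_of_nonneg_right _ hι
          exact mul_le_mul_of_nonneg_left hle (by positivity)
      _ ≤ 1 := hwin1

omit [NeZero L] [∀ i, NeZero (m i)] in
include hL hm hι hℓ' hχ hχ' in
/-- **The family `χ_0 := χ′`, `χ_j := χ ∘ up_j` has the consecutive two-block readings `r_j`** (gen 94's geometry: `abs_sub_level_zero_le` at `j = 0`,
`abs_sub_levels_le` at `j ≥ 1`). [folklore] [cite: Balaban1985BackgroundPropagators, (3.15)–(3.19) p.393, (3.49) p.399, (3.101) p.414] -/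
theorem family_readings {up : (j : ℕ) → TSite d (towerP L m j) → TSite d (towerP L m (n + 1))}
    (hup : ∀ j, j ≤ n + 1 → ∀ (z : TSite d (towerP L m j)) (i : Fin d), ((up j z i : ℕ)) = L ^ (n + 1 - j) * (z i : ℕ))
    (j : ℕ) (hj : j < n + 1) (c : Bond d (towerP L m j)) (b : Bond d (towerP L m (j + 1)))
    (hb : blockCoord L (towerP L m j) b.1 = c.1 ∨ blockCoord L (towerP L m j) b.1 = shift c.2 c.1) :
    |(Nat.rec (motive := fun j => TSite d (towerP L m j) → ℝ) χ' (fun j _ z => χ (up (j + 1) z)) j) c.1 -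
        (Nat.rec (motive := fun j => TSite d (towerP L m j) → ℝ) χ' (fun j _ z => χ (up (j + 1) z)) (j + 1)) b.1| ≤
      (if j = 0 then 3 * ℓ' + (L : ℝ) ^ (n + 1) * ι else 2 * d * (L : ℝ) ^ (n + 1 - j) * ι) := by
  cases j with
  | zero =>
    simp only [if_true]
    exact abs_sub_level_zero_le hL hup χ hι hℓ' hχ χ' hχ' c b hb
  | succ j' =>
    simp only [Nat.succ_ne_zero, if_false]
    have h := abs_sub_levels_le hL hm hup χ hι hχ (j := j' + 1) (by omega) c b hb
    have he : n + 1 - (j' + 1 + 1) + 1 = n + 1 - (j' + 1) := by omega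
    rw [he] at h
    exact_mod_cast h

/-! ## §2 The letters at the operator exponentials -/

include hL hm hMφ hMφ' hφ hφ' hεU hUε hι hℓ' hχ hχ' hMB hMF hwin0 hwin1 in
/-- **`dQ` AT THE TOWER IN THE COMPANION SHAPE**: `‖exp(κ•M_F)(Q_k(U)(exp(κ•(−M_B))f)) − Q_k(U)f‖ ≤ M_φ′M_φ·√(c₁∕(c₀L^{(n+1)d}))·(Π_{j≤n}(1 + √(L^d)(θ_j +
2‖κ‖r_j√(2(2d(102(d+1)²Lε_j)² + L^{−d})))) − Π_{j≤n}(1 + √(L^d)θ_j))·‖f‖`, `θ_j = √(2d)·102(d+1)²Lε_j`, readings `r_0 = 3ℓ′ + L^{n+1}ι`, `r_j = 2dL^{n+1−j}ι` —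
gen 93's `norm_conj_QkW_sub_le` at the family `χ_0 := χ′`, `χ_j := χ ∘ up_j`. [cite: Balaban1985BackgroundPropagators, (3.15)–(3.19) p.393, (3.49) p.399, (3.101) p.414] -/
theorem norm_expConj_QkW_sub_le (f : BondL2K ℂ d (towerP L m (n + 1)) c₀ W) :
    ‖exp (κ • MF) (QkW L m n φ U hL α hα1 hU1 hreg (c₀ := c₀) (c₁ := c₁) (exp (κ • (-MB)) f)) -
        QkW L m n φ U hL α hα1 hU1 hreg (c₀ := c₀) (c₁ := c₁) f‖ ≤
      Mφ' * Mφ * Real.sqrt (c₁ / (c₀ * ((L : ℝ) ^ (n + 1)) ^ d)) *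
        ((∏ j ∈ Finset.range (n + 1), (1 + Real.sqrt ((L : ℝ) ^ d) * (Real.sqrt (2 * d) * (102 * (d + 1) ^ 2 * L * εU j) +
            2 * (‖κ‖ * (if j = 0 then 3 * ℓ' + (L : ℝ) ^ (n + 1) * ι else 2 * d * (L : ℝ) ^ (n + 1 - j) * ι)) *
              Real.sqrt (2 * (2 * d * (102 * (d + 1) ^ 2 * L * εU j) ^ 2 + ((L : ℝ) ^ d)⁻¹))))) -
          ∏ j ∈ Finset.range (n + 1), (1 + Real.sqrt ((L : ℝ) ^ d) * (Real.sqrt (2 * d) * (102 * (d + 1) ^ 2 * L * εU j)))) * ‖f‖ := by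
  obtain ⟨up, hup⟩ := exists_levelEmbedding L m hL hm n
  have htop : ∀ z : TSite d (towerP L m (n + 1)), up (n + 1) z = z := fun z => by
    funext i; apply Fin.ext; rw [hup (n + 1) le_rfl, Nat.sub_self, pow_zero, one_mul]
  have hSinv : ∀ (g : BondL2K ℂ d (towerP L m (n + 1)) c₀ W) (b : Bond d (towerP L m (n + 1))),
      WL2.equiv ℂ (fun _ : Bond d (towerP L m (n + 1)) => c₀) W
          ((((exp (κ • (-MB)) : BondL2K ℂ d (towerP L m (n + 1)) c₀ W →L[ℂ] BondL2K ℂ d (towerP L m (n + 1)) c₀ W) :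
              BondL2K ℂ d (towerP L m (n + 1)) c₀ W →ₗ[ℂ] BondL2K ℂ d (towerP L m (n + 1)) c₀ W)) g) b =
        Complex.exp (-(κ * ((Nat.rec (motive := fun j => TSite d (towerP L m j) → ℝ) χ' (fun j _ z => χ (up (j + 1) z)) (n + 1)) b.1 : ℂ))) •
          WL2.equiv ℂ (fun _ : Bond d (towerP L m (n + 1)) => c₀) W g b := by
    intro g b
    rw [ContinuousLinearMap.coe_coe, equiv_exp_smul_neg_apply_complex MB (fun b => χ (bpos b)) hMB κ g b]
    show Complex.exp (-(κ * (χ b.1 : ℂ))) • _ = Complex.exp (-(κ * (χ (up (n + 1) b.1) : ℂ))) • _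
    rw [htop]
  have hSF : ∀ (g : BondL2K ℂ d m c₁ W) (c : Bond d m),
      WL2.equiv ℂ (fun _ : Bond d m => c₁) W
          ((((exp (κ • MF) : BondL2K ℂ d m c₁ W →L[ℂ] BondL2K ℂ d m c₁ W) : BondL2K ℂ d m c₁ W →ₗ[ℂ] BondL2K ℂ d m c₁ W)) g) c =
        Complex.exp (κ * ((Nat.rec (motive := fun j => TSite d (towerP L m j) → ℝ) χ' (fun j _ z => χ (up (j + 1) z)) 0) c.1 : ℂ)) •
          WL2.equiv ℂ (fun _ : Bond d m => c₁) W g c := fun g c => by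
    rw [ContinuousLinearMap.coe_coe, equiv_exp_smul_apply_complex MF (fun c => χ' (bpos c)) hMF κ g c]
    rfl
  have h := norm_conj_QkW_sub_le L m n hL φ hMφ hMφ' hφ hφ' (c₀ := c₀) (c₁ := c₁) U α hα1 hU1 hreg εU hεU hUε
    (Nat.rec (motive := fun j => TSite d (towerP L m j) → ℝ) χ' (fun j _ z => χ (up (j + 1) z)))
    (fun j => if j = 0 then 3 * ℓ' + (L : ℝ) ^ (n + 1) * ι else 2 * d * (L : ℝ) ^ (n + 1 - j) * ι)
    (readings_nonneg L n hι hℓ') (family_readings L m n hL hm hι hℓ' hχ hχ' hup) (readings_window L n hL hι hwin0 hwin1) hSinv hSF f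
  simpa only [ContinuousLinearMap.coe_coe] using h

include hL hm hMφ hMφ' hφ hφ' hεU hUε hι hℓ' hχ hχ' hMB hMF hwin0 hwin1 in
/-- **`dQ′` AT THE TOWER IN THE COMPANION SHAPE**: `‖exp(κ•M_B)(Q_k(U)†(exp(κ•(−M_F))g)) − Q_k(U)†g‖ ≤` the same constant `× ‖g‖` — gen 93's
`norm_conj_adjoint_QkW_sub_le` at the family `χ_0 := χ′`, `χ_j := χ ∘ up_j`. [cite: Balaban1985BackgroundPropagators, (3.15)–(3.16) p.393, (3.26) p.395, (3.49) p.399] -/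
theorem norm_expConj_adjoint_QkW_sub_le (g : BondL2K ℂ d m c₁ W) :
    ‖exp (κ • MB) (LinearMap.adjoint (QkW L m n φ U hL α hα1 hU1 hreg (c₀ := c₀) (c₁ := c₁)) (exp (κ • (-MF)) g)) -
        LinearMap.adjoint (QkW L m n φ U hL α hα1 hU1 hreg (c₀ := c₀) (c₁ := c₁)) g‖ ≤
      Mφ' * Mφ * Real.sqrt (c₁ / (c₀ * ((L : ℝ) ^ (n + 1)) ^ d)) *
        ((∏ j ∈ Finset.range (n + 1), (1 + Real.sqrt ((L : ℝ) ^ d) * (Real.sqrt (2 * d) * (102 * (d + 1) ^ 2 * L * εU j) +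
            2 * (‖κ‖ * (if j = 0 then 3 * ℓ' + (L : ℝ) ^ (n + 1) * ι else 2 * d * (L : ℝ) ^ (n + 1 - j) * ι)) *
              Real.sqrt (2 * (2 * d * (102 * (d + 1) ^ 2 * L * εU j) ^ 2 + ((L : ℝ) ^ d)⁻¹))))) -
          ∏ j ∈ Finset.range (n + 1), (1 + Real.sqrt ((L : ℝ) ^ d) * (Real.sqrt (2 * d) * (102 * (d + 1) ^ 2 * L * εU j)))) * ‖g‖ := by
  obtain ⟨up, hup⟩ := exists_levelEmbedding L m hL hm n
  have htop : ∀ z : TSite d (towerP L m (n + 1)), up (n + 1) z = z := fun z => by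
    funext i; apply Fin.ext; rw [hup (n + 1) le_rfl, Nat.sub_self, pow_zero, one_mul]
  have hS : ∀ (f : BondL2K ℂ d (towerP L m (n + 1)) c₀ W) (b : Bond d (towerP L m (n + 1))),
      WL2.equiv ℂ (fun _ : Bond d (towerP L m (n + 1)) => c₀) W
          ((((exp (κ • MB) : BondL2K ℂ d (towerP L m (n + 1)) c₀ W →L[ℂ] BondL2K ℂ d (towerP L m (n + 1)) c₀ W) :
              BondL2K ℂ d (towerP L m (n + 1)) c₀ W →ₗ[ℂ] BondL2K ℂ d (towerP L m (n + 1)) c₀ W)) f) b =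
        Complex.exp (κ * ((Nat.rec (motive := fun j => TSite d (towerP L m j) → ℝ) χ' (fun j _ z => χ (up (j + 1) z)) (n + 1)) b.1 : ℂ)) •
          WL2.equiv ℂ (fun _ : Bond d (towerP L m (n + 1)) => c₀) W f b := by
    intro f b
    rw [ContinuousLinearMap.coe_coe, equiv_exp_smul_apply_complex MB (fun b => χ (bpos b)) hMB κ f b]
    show Complex.exp (κ * (χ b.1 : ℂ)) • _ = Complex.exp (κ * (χ (up (n + 1) b.1) : ℂ)) • _
    rw [htop]
  have hSFinv : ∀ (g : BondL2K ℂ d m c₁ W) (c : Bond d m),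
      WL2.equiv ℂ (fun _ : Bond d m => c₁) W
          ((((exp (κ • (-MF)) : BondL2K ℂ d m c₁ W →L[ℂ] BondL2K ℂ d m c₁ W) : BondL2K ℂ d m c₁ W →ₗ[ℂ] BondL2K ℂ d m c₁ W)) g) c =
        Complex.exp (-(κ * ((Nat.rec (motive := fun j => TSite d (towerP L m j) → ℝ) χ' (fun j _ z => χ (up (j + 1) z)) 0) c.1 : ℂ))) •
          WL2.equiv ℂ (fun _ : Bond d m => c₁) W g c := fun g c => by
    rw [ContinuousLinearMap.coe_coe, equiv_exp_smul_neg_apply_complex MF (fun c => χ' (bpos c)) hMF κ g c]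
    rfl
  have h := norm_conj_adjoint_QkW_sub_le L m n hL φ hMφ hMφ' hφ hφ' (c₀ := c₀) (c₁ := c₁) U α hα1 hU1 hreg εU hεU hUε
    (Nat.rec (motive := fun j => TSite d (towerP L m j) → ℝ) χ' (fun j _ z => χ (up (j + 1) z)))
    (fun j => if j = 0 then 3 * ℓ' + (L : ℝ) ^ (n + 1) * ι else 2 * d * (L : ℝ) ^ (n + 1 - j) * ι)
    (readings_nonneg L n hι hℓ') (family_readings L m n hL hm hι hℓ' hχ hχ' hup) (readings_window L n hL hι hwin0 hwin1) hS hSFinv g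
  simpa only [LinearMap.comp_apply, ContinuousLinearMap.coe_coe] using h

include hL hm hMφ hMφ' hφ hφ' hεU hUε hι hℓ' hχ hχ' hMB hMF hwin0 hwin1 in
/-- **THE THREE TOWER `Q`-LETTERS BUNDLED IN THE `∃ Q_κ Q′_κ` SHAPE** of (CDT) `B9Eq326ConjugatedDeltaATower.norm_conjG1k_le` ∕ the tower (D0)-type ENDs:
`Q_κ := exp(κ•M_F)∘Q_k(U)∘exp(κ•(−M_B))`, `Q′_κ := exp(κ•M_B)∘Q_k(U)†∘exp(κ•(−M_F))`, the factorisation `exp(κ•M_B)(Q_k†(a•Q_k(exp(κ•(−M_B))f))) =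
a•Q′_κ(Q_κf)` and the two bounds. [cite: Balaban1985BackgroundPropagators, (3.15)–(3.19) p.393, (3.26) p.395, (3.49) p.399, (3.101) p.414] -/
theorem exists_expConj_Qk_letters (a : ℝ) :
    ∃ (Qk : BondL2K ℂ d (towerP L m (n + 1)) c₀ W →ₗ[ℂ] BondL2K ℂ d m c₁ W)
      (Qk' : BondL2K ℂ d m c₁ W →ₗ[ℂ] BondL2K ℂ d (towerP L m (n + 1)) c₀ W),
      (∀ f, exp (κ • MB) (LinearMap.adjoint (QkW L m n φ U hL α hα1 hU1 hreg (c₀ := c₀) (c₁ := c₁))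
          (((a : ℝ) : ℂ) • QkW L m n φ U hL α hα1 hU1 hreg (c₀ := c₀) (c₁ := c₁) (exp (κ • (-MB)) f))) = ((a : ℝ) : ℂ) • Qk' (Qk f)) ∧
      (∀ f, ‖Qk f - QkW L m n φ U hL α hα1 hU1 hreg (c₀ := c₀) (c₁ := c₁) f‖ ≤
        Mφ' * Mφ * Real.sqrt (c₁ / (c₀ * ((L : ℝ) ^ (n + 1)) ^ d)) *
          ((∏ j ∈ Finset.range (n + 1), (1 + Real.sqrt ((L : ℝ) ^ d) * (Real.sqrt (2 * d) * (102 * (d + 1) ^ 2 * L * εU j) +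
              2 * (‖κ‖ * (if j = 0 then 3 * ℓ' + (L : ℝ) ^ (n + 1) * ι else 2 * d * (L : ℝ) ^ (n + 1 - j) * ι)) *
                Real.sqrt (2 * (2 * d * (102 * (d + 1) ^ 2 * L * εU j) ^ 2 + ((L : ℝ) ^ d)⁻¹))))) -
            ∏ j ∈ Finset.range (n + 1), (1 + Real.sqrt ((L : ℝ) ^ d) * (Real.sqrt (2 * d) * (102 * (d + 1) ^ 2 * L * εU j)))) * ‖f‖) ∧
      (∀ g, ‖Qk' g - LinearMap.adjoint (QkW L m n φ U hL α hα1 hU1 hreg (c₀ := c₀) (c₁ := c₁)) g‖ ≤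
        Mφ' * Mφ * Real.sqrt (c₁ / (c₀ * ((L : ℝ) ^ (n + 1)) ^ d)) *
          ((∏ j ∈ Finset.range (n + 1), (1 + Real.sqrt ((L : ℝ) ^ d) * (Real.sqrt (2 * d) * (102 * (d + 1) ^ 2 * L * εU j) +
              2 * (‖κ‖ * (if j = 0 then 3 * ℓ' + (L : ℝ) ^ (n + 1) * ι else 2 * d * (L : ℝ) ^ (n + 1 - j) * ι)) *
                Real.sqrt (2 * (2 * d * (102 * (d + 1) ^ 2 * L * εU j) ^ 2 + ((L : ℝ) ^ d)⁻¹))))) -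
            ∏ j ∈ Finset.range (n + 1), (1 + Real.sqrt ((L : ℝ) ^ d) * (Real.sqrt (2 * d) * (102 * (d + 1) ^ 2 * L * εU j)))) * ‖g‖) := by
  have hinv : ∀ g : BondL2K ℂ d m c₁ W, exp (κ • (-MF)) (exp (κ • MF) g) = g := exp_neg_apply_exp MF (fun c => χ' (bpos c)) hMF κ
  refine ⟨((exp (κ • MF) : BondL2K ℂ d m c₁ W →L[ℂ] BondL2K ℂ d m c₁ W) : BondL2K ℂ d m c₁ W →ₗ[ℂ] BondL2K ℂ d m c₁ W) ∘ₗ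
      QkW L m n φ U hL α hα1 hU1 hreg (c₀ := c₀) (c₁ := c₁) ∘ₗ
      ((exp (κ • (-MB)) : BondL2K ℂ d (towerP L m (n + 1)) c₀ W →L[ℂ] BondL2K ℂ d (towerP L m (n + 1)) c₀ W) :
        BondL2K ℂ d (towerP L m (n + 1)) c₀ W →ₗ[ℂ] BondL2K ℂ d (towerP L m (n + 1)) c₀ W),
    ((exp (κ • MB) : BondL2K ℂ d (towerP L m (n + 1)) c₀ W →L[ℂ] BondL2K ℂ d (towerP L m (n + 1)) c₀ W) :
        BondL2K ℂ d (towerP L m (n + 1)) c₀ W →ₗ[ℂ] BondL2K ℂ d (towerP L m (n + 1)) c₀ W) ∘ₗ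
      LinearMap.adjoint (QkW L m n φ U hL α hα1 hU1 hreg (c₀ := c₀) (c₁ := c₁)) ∘ₗ
      ((exp (κ • (-MF)) : BondL2K ℂ d m c₁ W →L[ℂ] BondL2K ℂ d m c₁ W) : BondL2K ℂ d m c₁ W →ₗ[ℂ] BondL2K ℂ d m c₁ W),
    fun f => ?_, fun f => ?_, fun g => ?_⟩
  · simp only [LinearMap.comp_apply, ContinuousLinearMap.coe_coe, hinv, map_smul]
  · simpa only [LinearMap.comp_apply, ContinuousLinearMap.coe_coe] using
      norm_expConj_QkW_sub_le L m n hL hm φ hMφ hMφ' hφ hφ' U α hα1 hU1 hreg εU hεU hUε hι hℓ' hχ hχ' hMB hMF hwin0 hwin1 f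
  · simpa only [LinearMap.comp_apply, ContinuousLinearMap.coe_coe] using
      norm_expConj_adjoint_QkW_sub_le L m n hL hm φ hMφ hMφ' hφ hφ' U α hα1 hU1 hreg εU hεU hUε hι hℓ' hχ hχ' hMB hMF hwin0 hwin1 g

/-! ## §3 The tower letter LINEAR IN THE RADIUS (the `∃`-first ENDs' shape) -/

omit [NeZero L] [∀ i, NeZero (m i)] [CompleteSpace 𝔸] [NormOneClass 𝔸] [FiniteDimensional ℂ W] [Fact (0 < c₀)] [Fact (0 < c₁)] in
/-- `Π_{j∈s}(1 + a_j + b_j) − Π_{j∈s}(1 + a_j) ≤ (Σ_{j∈s} b_j)·exp(Σ_{j∈s}(a_j + b_j))` for `a_j, b_j ≥ 0` (`1 + x ≤ e^x`, induction on `s`). [folklore]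
[cite: Balaban1985BackgroundPropagators, (3.49) p.399] -/
theorem prod_add_sub_prod_le {ι' : Type*} (s : Finset ι') (a b : ι' → ℝ) (ha : ∀ j ∈ s, 0 ≤ a j) (hb : ∀ j ∈ s, 0 ≤ b j) :
    ∏ j ∈ s, (1 + a j + b j) - ∏ j ∈ s, (1 + a j) ≤ (∑ j ∈ s, b j) * Real.exp (∑ j ∈ s, (a j + b j)) := by
  classical
  induction s using Finset.induction_on with
  | empty => simp
  | insert i s hi ih =>
    have ha' : ∀ j ∈ s, 0 ≤ a j := fun j hj => ha j (Finset.mem_insert_of_mem hj)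
    have hb' : ∀ j ∈ s, 0 ≤ b j := fun j hj => hb j (Finset.mem_insert_of_mem hj)
    have hai : 0 ≤ a i := ha i (Finset.mem_insert_self i s)
    have hbi : 0 ≤ b i := hb i (Finset.mem_insert_self i s)
    have ih' := ih ha' hb'
    rw [Finset.prod_insert hi, Finset.prod_insert hi, Finset.sum_insert hi, Finset.sum_insert hi]
    set P := ∏ j ∈ s, (1 + a j + b j) with hP
    set P0 := ∏ j ∈ s, (1 + a j) with hP0
    set A := ∑ j ∈ s, (a j + b j) with hA
    set B := ∑ j ∈ s, b j with hB
    have hPnn : 0 ≤ P := Finset.prod_nonneg fun j hj => by have := ha' j hj; have := hb' j hj; positivity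
    have hBnn : 0 ≤ B := Finset.sum_nonneg hb'
    have hPexp : P ≤ Real.exp A := by
      rw [hP, hA, Real.exp_sum]
      exact Finset.prod_le_prod (fun j hj => by have := ha' j hj; have := hb' j hj; positivity)
        fun j hj => by have h := Real.add_one_le_exp (a j + b j); linarith
    have h1 : 1 + a i + b i ≤ Real.exp (a i + b i) := by have h := Real.add_one_le_exp (a i + b i); linarith
    have key : (1 + a i + b i) * P - (1 + a i) * P0 = (1 + a i) * (P - P0) + b i * P := by ring
    rw [key]
    calc (1 + a i) * (P - P0) + b i * P ≤ (1 + a i + b i) * (B * Real.exp A) + b i * Real.exp A := by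
          have h2 : (1 + a i) * (P - P0) ≤ (1 + a i + b i) * (B * Real.exp A) :=
            calc (1 + a i) * (P - P0) ≤ (1 + a i) * (B * Real.exp A) := mul_le_mul_of_nonneg_left ih' (by positivity)
              _ ≤ (1 + a i + b i) * (B * Real.exp A) := mul_le_mul_of_nonneg_right (by linarith) (by positivity)
          have h3 : b i * P ≤ b i * Real.exp A := mul_le_mul_of_nonneg_left hPexp hbi
          linarith
      _ ≤ Real.exp (a i + b i) * (B * Real.exp A) + b i * (Real.exp (a i + b i) * Real.exp A) := by
          have h4 : (1 + a i + b i) * (B * Real.exp A) ≤ Real.exp (a i + b i) * (B * Real.exp A) :=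
            mul_le_mul_of_nonneg_right h1 (by positivity)
          have h5 : b i * Real.exp A ≤ b i * (Real.exp (a i + b i) * Real.exp A) := by
            apply mul_le_mul_of_nonneg_left _ hbi
            have : 1 ≤ Real.exp (a i + b i) := Real.one_le_exp (by positivity)
            nlinarith [Real.exp_pos A]
          linarith
      _ = (b i + B) * Real.exp (a i + b i + A) := by rw [Real.exp_add (a i + b i) A]; ring

include hL hm hMφ hMφ' hφ hφ' hεU hUε hι hℓ' hχ hχ' hMB hMF hwin0 hwin1 in
/-- **`dQ` AT THE TOWER, LINEAR IN THE RADIUS**: for `‖κ‖ ≤ R`,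
`‖exp(κ•M_F)(Q_k(U)(exp(κ•(−M_B))f)) − Q_k(U)f‖ ≤ (N_β(R)·‖κ‖)·‖f‖` with
`N_β(R) = M_φ′M_φ·√(c₁∕(c₀L^{(n+1)d}))·(Σ_{j≤n} 2√(L^d)·r_j·s_j)·exp(Σ_{j≤n} √(L^d)(θ_j + 2R·r_j·s_j))`, `s_j = √(2(2d(102(d+1)²Lε_j)² + L^{−d}))`,
`θ_j = √(2d)·102(d+1)²Lε_j`, readings `r_0 = 3ℓ′ + L^{n+1}ι`, `r_j = 2dL^{n+1−j}ι` — §2 + the product inequality; the slope is a finite sum∕product over the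
levels whose height-free reading (diagonal `√(c₁∕(c₀L^{(n+1)d})) = 1`, geometric `ε_j`, `Σ_j r_j = O(ℓ′ + dℓ)` at `ι = ℓη`) is the consumer's — the `(N_β·r)`
shape of the tower `∃`-first END (EH1T). [cite: Balaban1985BackgroundPropagators, (3.15)–(3.19) p.393, (3.49) p.399, (3.101) p.414] -/
theorem norm_expConj_QkW_sub_le_linear {R : ℝ} (hκR : ‖κ‖ ≤ R) (f : BondL2K ℂ d (towerP L m (n + 1)) c₀ W) :
    ‖exp (κ • MF) (QkW L m n φ U hL α hα1 hU1 hreg (c₀ := c₀) (c₁ := c₁) (exp (κ • (-MB)) f)) -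
        QkW L m n φ U hL α hα1 hU1 hreg (c₀ := c₀) (c₁ := c₁) f‖ ≤
      (Mφ' * Mφ * Real.sqrt (c₁ / (c₀ * ((L : ℝ) ^ (n + 1)) ^ d)) *
          ((∑ j ∈ Finset.range (n + 1), 2 * Real.sqrt ((L : ℝ) ^ d) *
              (if j = 0 then 3 * ℓ' + (L : ℝ) ^ (n + 1) * ι else 2 * d * (L : ℝ) ^ (n + 1 - j) * ι) *
              Real.sqrt (2 * (2 * d * (102 * (d + 1) ^ 2 * L * εU j) ^ 2 + ((L : ℝ) ^ d)⁻¹))) *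
            Real.exp (∑ j ∈ Finset.range (n + 1), Real.sqrt ((L : ℝ) ^ d) * (Real.sqrt (2 * d) * (102 * (d + 1) ^ 2 * L * εU j) +
              2 * (R * (if j = 0 then 3 * ℓ' + (L : ℝ) ^ (n + 1) * ι else 2 * d * (L : ℝ) ^ (n + 1 - j) * ι)) *
                Real.sqrt (2 * (2 * d * (102 * (d + 1) ^ 2 * L * εU j) ^ 2 + ((L : ℝ) ^ d)⁻¹))))) * ‖κ‖) * ‖f‖ := by
  have hc₀ : 0 < c₀ := Fact.out
  have hc₁ : 0 < c₁ := Fact.out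
  have h := norm_expConj_QkW_sub_le L m n hL hm φ hMφ hMφ' hφ hφ' U α hα1 hU1 hreg εU hεU hUε hι hℓ' hχ hχ' hMB hMF hwin0 hwin1 f
  refine h.trans (mul_le_mul_of_nonneg_right ?_ (norm_nonneg _))
  -- abbreviations: `a_j = √(L^d)θ_j`, `b_j(t) = √(L^d)·2(t·r_j)·s_j`
  set r : ℕ → ℝ := fun j => if j = 0 then 3 * ℓ' + (L : ℝ) ^ (n + 1) * ι else 2 * d * (L : ℝ) ^ (n + 1 - j) * ι with hr
  set sj : ℕ → ℝ := fun j => Real.sqrt (2 * (2 * d * (102 * (d + 1) ^ 2 * L * εU j) ^ 2 + ((L : ℝ) ^ d)⁻¹)) with hsj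
  set θ : ℕ → ℝ := fun j => Real.sqrt (2 * d) * (102 * (d + 1) ^ 2 * L * εU j) with hθ
  have hr0 : ∀ j, 0 ≤ r j := fun j => by rw [hr]; exact readings_nonneg L n hι hℓ' j
  have hsj0 : ∀ j, 0 ≤ sj j := fun j => Real.sqrt_nonneg _
  have hθ0 : ∀ j, 0 ≤ θ j := fun j => by rw [hθ]; have := hεU j; positivity
  have hM : 0 ≤ Mφ' * Mφ * Real.sqrt (c₁ / (c₀ * ((L : ℝ) ^ (n + 1)) ^ d)) := by positivity
  -- the product difference in the abbreviations
  have hprod : ((∏ j ∈ Finset.range (n + 1), (1 + Real.sqrt ((L : ℝ) ^ d) * (θ j + 2 * (‖κ‖ * r j) * sj j))) -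
        ∏ j ∈ Finset.range (n + 1), (1 + Real.sqrt ((L : ℝ) ^ d) * θ j)) ≤
      (∑ j ∈ Finset.range (n + 1), Real.sqrt ((L : ℝ) ^ d) * (2 * (‖κ‖ * r j) * sj j)) *
        Real.exp (∑ j ∈ Finset.range (n + 1), (Real.sqrt ((L : ℝ) ^ d) * θ j + Real.sqrt ((L : ℝ) ^ d) * (2 * (‖κ‖ * r j) * sj j))) := by
    have h := prod_add_sub_prod_le (Finset.range (n + 1)) (fun j => Real.sqrt ((L : ℝ) ^ d) * θ j)
      (fun j => Real.sqrt ((L : ℝ) ^ d) * (2 * (‖κ‖ * r j) * sj j)) (fun j _ => by have := hθ0 j; positivity)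
      (fun j _ => by have := hr0 j; have := hsj0 j; positivity)
    have heq : ∀ j, 1 + Real.sqrt ((L : ℝ) ^ d) * θ j + Real.sqrt ((L : ℝ) ^ d) * (2 * (‖κ‖ * r j) * sj j) =
        1 + Real.sqrt ((L : ℝ) ^ d) * (θ j + 2 * (‖κ‖ * r j) * sj j) := fun j => by ring
    simp only [heq] at h
    exact h
  -- the sum is `‖κ‖ ·` the slope's sum; the exponent is monotone in `‖κ‖ ≤ R`
  have hsum : ∑ j ∈ Finset.range (n + 1), Real.sqrt ((L : ℝ) ^ d) * (2 * (‖κ‖ * r j) * sj j) =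
      (∑ j ∈ Finset.range (n + 1), 2 * Real.sqrt ((L : ℝ) ^ d) * r j * sj j) * ‖κ‖ := by
    rw [Finset.sum_mul]; exact Finset.sum_congr rfl fun j _ => by ring
  have hexp : Real.exp (∑ j ∈ Finset.range (n + 1), (Real.sqrt ((L : ℝ) ^ d) * θ j + Real.sqrt ((L : ℝ) ^ d) * (2 * (‖κ‖ * r j) * sj j))) ≤
      Real.exp (∑ j ∈ Finset.range (n + 1), Real.sqrt ((L : ℝ) ^ d) * (θ j + 2 * (R * r j) * sj j)) := by
    apply Real.exp_le_exp.mpr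
    apply Finset.sum_le_sum
    intro j _
    have h1 : Real.sqrt ((L : ℝ) ^ d) * (2 * (‖κ‖ * r j) * sj j) ≤ Real.sqrt ((L : ℝ) ^ d) * (2 * (R * r j) * sj j) := by
      apply mul_le_mul_of_nonneg_left _ (Real.sqrt_nonneg _)
      apply mul_le_mul_of_nonneg_right _ (hsj0 j)
      exact mul_le_mul_of_nonneg_left (mul_le_mul_of_nonneg_right hκR (hr0 j)) (by norm_num)
    calc _ ≤ Real.sqrt ((L : ℝ) ^ d) * θ j + Real.sqrt ((L : ℝ) ^ d) * (2 * (R * r j) * sj j) := add_le_add le_rfl h1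
      _ = _ := by ring
  have hS0 : 0 ≤ (∑ j ∈ Finset.range (n + 1), 2 * Real.sqrt ((L : ℝ) ^ d) * r j * sj j) * ‖κ‖ :=
    mul_nonneg (Finset.sum_nonneg fun j _ => by have := hr0 j; have := hsj0 j; positivity) (norm_nonneg _)
  calc Mφ' * Mφ * Real.sqrt (c₁ / (c₀ * ((L : ℝ) ^ (n + 1)) ^ d)) *
        ((∏ j ∈ Finset.range (n + 1), (1 + Real.sqrt ((L : ℝ) ^ d) * (θ j + 2 * (‖κ‖ * r j) * sj j))) -
          ∏ j ∈ Finset.range (n + 1), (1 + Real.sqrt ((L : ℝ) ^ d) * θ j))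
      ≤ Mφ' * Mφ * Real.sqrt (c₁ / (c₀ * ((L : ℝ) ^ (n + 1)) ^ d)) *
        (((∑ j ∈ Finset.range (n + 1), 2 * Real.sqrt ((L : ℝ) ^ d) * r j * sj j) * ‖κ‖) *
          Real.exp (∑ j ∈ Finset.range (n + 1), Real.sqrt ((L : ℝ) ^ d) * (θ j + 2 * (R * r j) * sj j))) := by
        apply mul_le_mul_of_nonneg_left _ hM
        rw [← hsum]
        exact hprod.trans (mul_le_mul_of_nonneg_left hexp (hsum ▸ hS0))
    _ = _ := by ring

end Literature.MathematicalPhysics.QuantumFieldTheory.Balaban1983to89.B9Eq349ConjugatedQTowerLettersCompanion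

end
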